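import Summits.CriticalPhenomena.PercolationContinuityZ3.Theorems.PercNearOneGluingNoHeavyLowerTailSahiCombTriWSandwich
import Summits.CriticalPhenomena.PercolationContinuityZ3.Theorems.PercNearOneGluingNoHeavyLowerTailSahiCombTriWFibreFourCert

/-!
# `TRI_W(a) ≥ 0` for EVERY index cube when the fibre cube has dimension four, II: transport and the theorem

Support file of the one-cut programme (crux `NoHeavyLowerTail`, stmt-CriticalPhenomena-4575; cell `prim-masterthm`, seat P5 gen 24;
memo `FROM-prim-masterthm-p5-g24-SANDWICH.md`).  The companion `…SahiCombTriWFibreFourCert` checks (by `native_decide`, in the 16-point bitmask model) the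
sandwich rows `c·L_P(A,B) ≤ k_P(A,B) ≤ c·U_P(A,B)` for every up-set `P` of `2^4` and all up-sets `A, B`.  Here the rows are transported back to the cube
`Finset (Finset (Fin 4))` (`uForm_eq_uM`, `lForm_eq_lM`, `kM_eq_kF`), repackaged as a `SandwichCert` of `…SahiCombTriWSandwich` with monotone one-family
literals (`sandwichCert_fin_four`), and the SANDWICH PRINCIPLE (`triW_nonneg_of_sandwichCert`) gives
**`triW_nonneg_fin_four` — `TriWIneq` on every cell `(a, 4)`, all `a`** (before: `n ≤ 3` in Lean, `…TriWFibreThree`; `(a,4)` only by exact kit computation, g23).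
Note: the certificates for the three `K₂₂`-orbit families use antipodal-pair JOIN literals — the first landed instance of a literal (non point-pair) certificate.
HONEST LABEL: depends on the computational file (`native_decide`); `TriWIneq` for `n ≥ 5` stays OPEN in Lean (n = 5: all 210 `S₅`-classes have exact LP
certificates, kit j169428 — 205 diagonal, 4 with antipodal-pair literals). [this work]
-/

namespace Summit.CriticalPhenomena.PercolationContinuityZ3.Theorems

namespace FiveUpSet

open Finset

/-! ### From the cube to the 16-point model -/

/-- The image of a family of the cube `Finset (Fin 4)` in the 16-point model. [this work] -/
abbrev img16 (A : Finset (Finset (Fin 4))) : Finset (Fin 16) := A.map pt16.toEmbedding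

/-- The antipodal image goes to the image under `Fin.revPerm`. [this work] -/
theorem img16_refl (A : Finset (Finset (Fin 4))) : img16 (refl A) = (img16 A).image Fin.revPerm := by
  unfold img16
  rw [← image_complEquiv, LatticeFiveUpSet.map_image_of_semiconj (complEquiv (Fin 4)) Fin.revPerm pt16.toEmbedding pt16_compl A]

/-- Triple intersections are counted in the model. [this work] -/
theorem card_inter₃_img16 (P A B : Finset (Finset (Fin 4))) :
    ((P ∩ A ∩ B).card : ℤ) = ((img16 P ∩ img16 A ∩ img16 B).card : ℤ) := by
  unfold img16
  rw [← Finset.map_inter, ← Finset.map_inter, Finset.card_map]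

/-- Triple intersections of the model are popcounts of masks. [this work] -/
theorem card_inter₃_pc16 (X Y Z : Finset (Fin 16)) : (X ∩ Y ∩ Z).card = pc16 (Nat.land (Nat.land (m16 X) (m16 Y)) (m16 Z)) := by
  rw [card_eq_pc16, m16_inter, m16_inter]

/-- **Transport of the upper form** to masks. [this work] -/
theorem uForm_eq_uM (P A B : Finset (Finset (Fin 4))) :
    uForm P A B = uM (m16 (img16 P)) (m16 ((img16 P).image Fin.revPerm)) (m16 (img16 A)) (m16 (img16 B)) := by
  unfold uForm uM
  rw [card_inter₃_img16, card_inter₃_img16, img16_refl, card_inter₃_pc16, card_inter₃_pc16]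

/-- **Transport of the lower form** to masks. [this work] -/
theorem lForm_eq_lM (P A B : Finset (Finset (Fin 4))) :
    lForm P A B = lM (m16 (img16 P)) (m16 ((img16 P).image Fin.revPerm)) (m16 (img16 A)) (m16 ((img16 A).image Fin.revPerm))
      (m16 (img16 B)) (m16 ((img16 B).image Fin.revPerm)) := by
  unfold lForm lM
  rw [card_inter₃_img16, card_inter₃_img16, card_inter₃_img16, img16_refl, img16_refl, img16_refl, card_inter₃_pc16, card_inter₃_pc16,
    card_inter₃_pc16]

/-! ### Literals on the cube -/

/-- Semantics of a coded literal on families of the cube: point membership / join / meet of the points `ptOfNat4 i`. [this work] -/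
def litF (t : LitCode) (A : Finset (Finset (Fin 4))) : Bool :=
  if t.1 = 0 then decide (ptOfNat4 t.2.1 ∈ A)
  else if t.1 = 1 then (decide (ptOfNat4 t.2.1 ∈ A) || decide (ptOfNat4 t.2.2 ∈ A))
  else (decide (ptOfNat4 t.2.1 ∈ A) && decide (ptOfNat4 t.2.2 ∈ A))

/-- Coded literals are monotone one-family literals. [this work] -/
theorem monoLit_litF (t : LitCode) : MonoLit (litF t) := by
  intro A A' hAA' h
  unfold litF at h ⊢
  by_cases h0 : t.1 = 0
  · rw [if_pos h0] at h ⊢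
    rw [decide_eq_true_eq] at h ⊢
    exact hAA' h
  · rw [if_neg h0] at h ⊢
    by_cases h1 : t.1 = 1
    · rw [if_pos h1] at h ⊢
      rw [Bool.or_eq_true, decide_eq_true_eq, decide_eq_true_eq] at h ⊢
      rcases h with h | h
      · exact Or.inl (hAA' h)
      · exact Or.inr (hAA' h)
    · rw [if_neg h1] at h ⊢
      rw [Bool.and_eq_true, decide_eq_true_eq, decide_eq_true_eq] at h ⊢
      exact ⟨hAA' h.1, hAA' h.2⟩

/-- Point membership on the cube is `testBit` of the model mask. [this work] -/
theorem decide_mem_eq_testBit (A : Finset (Finset (Fin 4))) {i : ℕ} (hi : i < 16) :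
    decide (ptOfNat4 i ∈ A) = (m16 (img16 A)).testBit i := by
  have hp : pt16 (ptOfNat4 i) = ⟨i, hi⟩ := pt16_ptOfNat4 ⟨i, hi⟩
  have hm : ptOfNat4 i ∈ A ↔ (⟨i, hi⟩ : Fin 16) ∈ img16 A := by
    rw [← hp]
    exact (Finset.mem_map' pt16.toEmbedding).symm
  rw [Bool.eq_iff_iff, decide_eq_true_iff, hm]
  exact mem_iff_testBit_m16 (img16 A) ⟨i, hi⟩

/-- Coded literals agree with their mask evaluation (indices `< 16`). [this work] -/
theorem litF_eq_litM (t : LitCode) (h1 : t.2.1 < 16) (h2 : t.2.2 < 16) (A : Finset (Finset (Fin 4))) :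
    litF t A = litM t (m16 (img16 A)) := by
  unfold litF litM
  rw [decide_mem_eq_testBit A h1, decide_mem_eq_testBit A h2]

/-- The summand of an atom on the cube. [this work] -/
def atomF (A B : Finset (Finset (Fin 4))) (t : Atom16) : ℤ := (t.2.2 : ℤ) * bInd (litF t.1) A * bInd (litF t.2.1) B

/-- Atom summands agree with their mask evaluation. [this work] -/
theorem atomM_eq_atomF (A B : Finset (Finset (Fin 4))) (t : Atom16)
    (h : t.1.2.1 < 16 ∧ t.1.2.2 < 16 ∧ t.2.1.2.1 < 16 ∧ t.2.1.2.2 < 16) :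
    atomM (m16 (img16 A)) (m16 (img16 B)) t = atomF A B t := by
  unfold atomM atomF bInd
  rw [← litF_eq_litM t.1 h.1 h.2.1 A, ← litF_eq_litM t.2.1 h.2.2.1 h.2.2.2 B]
  cases litF t.1 A <;> cases litF t.2.1 B <;> simp

/-- The bilinear form of an atom list on the cube. [this work] -/
def kF (l : List Atom16) (A B : Finset (Finset (Fin 4))) : ℤ := (l.map (atomF A B)).sum

/-- The mask bilinear form agrees with the cube one (indices `< 16`). [this work] -/
theorem kM_eq_kF (l : List Atom16) (hl : ∀ t ∈ l, t.1.2.1 < 16 ∧ t.1.2.2 < 16 ∧ t.2.1.2.1 < 16 ∧ t.2.1.2.2 < 16)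
    (A B : Finset (Finset (Fin 4))) : kM l (m16 (img16 A)) (m16 (img16 B)) = kF l A B := by
  unfold kM kF
  rw [List.map_congr_left (fun t ht => atomM_eq_atomF A B t (hl t ht))]

/-! ### The certificate of a test family as a `SandwichCert` -/

/-- The certificate data of a family of the cube (multiplier, atom list). [this work] -/
def cert4 (P : Finset (Finset (Fin 4))) : ℕ × List Atom16 := certTab4 (m16 (img16 P))

/-- The weights of the certificate of `P`. [this work] -/
def lam4 (P : Finset (Finset (Fin 4))) (j : Fin (cert4 P).2.length) : ℕ := ((cert4 P).2.get j).2.2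

/-- The left literals of the certificate of `P`. [this work] -/
def litV4 (P : Finset (Finset (Fin 4))) (j : Fin (cert4 P).2.length) : Finset (Finset (Fin 4)) → Bool := litF ((cert4 P).2.get j).1

/-- The right literals of the certificate of `P`. [this work] -/
def litB4 (P : Finset (Finset (Fin 4))) (j : Fin (cert4 P).2.length) : Finset (Finset (Fin 4)) → Bool := litF ((cert4 P).2.get j).2.1

/-- The `litVal` of the packaged certificate is the list bilinear form. [this work] -/
theorem litVal_cert4 (P A B : Finset (Finset (Fin 4))) : litVal (lam4 P) (litV4 P) (litB4 P) A B = kF (cert4 P).2 A B := by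
  unfold litVal kF lam4 litV4 litB4
  rw [← List.ofFn_get (cert4 P).2, List.map_ofFn, List.sum_ofFn, List.ofFn_get]
  rfl

/-- The row data of an up-set: its mask pair is tabulated, its certificate is well-formed, and every row holds (from the computational check). [this work] -/
theorem row_of_mem (P A B : Finset (Finset (Fin 4))) (hP : IsUpperSet (P : Set (Finset (Fin 4))))
    (hA : IsUpperSet (A : Set (Finset (Fin 4)))) (hB : IsUpperSet (B : Set (Finset (Fin 4)))) :
    0 < (cert4 P).1 ∧ (∀ t ∈ (cert4 P).2, t.1.2.1 < 16 ∧ t.1.2.2 < 16 ∧ t.2.1.2.1 < 16 ∧ t.2.1.2.2 < 16) ∧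
    rowM (cert4 P).1 (cert4 P).2 (m16 (img16 P)) (m16 ((img16 P).image Fin.revPerm))
      (m16 (img16 A)) (m16 ((img16 A).image Fin.revPerm)) (m16 (img16 B)) (m16 ((img16 B).image Fin.revPerm)) = true := by
  have hQ := m16_pair_mem _ (map_mem_ups16 hP)
  have hA' := m16_pair_mem _ (map_mem_ups16 hA)
  have hB' := m16_pair_mem _ (map_mem_ups16 hB)
  have hwf := certTab4_wf
  rw [List.all_eq_true] at hwf
  have hwfQ := hwf _ hQ
  rw [Bool.and_eq_true, decide_eq_true_eq, List.all_eq_true] at hwfQ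
  have hall := checkQ_all
  rw [List.all_eq_true] at hall
  have hq := hall _ hQ
  unfold checkQ at hq
  dsimp only at hq
  rw [List.all_eq_true] at hq
  have hqa := hq _ hA'
  rw [List.all_eq_true] at hqa
  have hrow := hqa _ hB'
  refine ⟨hwfQ.1, fun t ht => ?_, hrow⟩
  have := hwfQ.2 t ht
  rwa [decide_eq_true_eq] at this

/-- **Sandwich certificates for every up-set of `2^4`.** [this work] -/
theorem sandwichCert_fin_four (P : Finset (Finset (Fin 4))) (hP : IsUpperSet (P : Set (Finset (Fin 4)))) :
    SandwichCert P (cert4 P).1 (lam4 P) (litV4 P) (litB4 P) := by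
  intro A B hA hB
  obtain ⟨-, hwf, hrow⟩ := row_of_mem P A B hP hA hB
  unfold rowM at hrow
  rw [Bool.and_eq_true, decide_eq_true_eq, decide_eq_true_eq, ← uForm_eq_uM, ← lForm_eq_lM, kM_eq_kF _ hwf] at hrow
  rw [litVal_cert4]
  exact hrow

variable {β : Type} [DecidableEq β] [Fintype β]

/-- **`TriWIneq` on every cell `(a, 4)`**: for the fibre cube `Finset (Fin 4)`, EVERY up-set `P`, EVERY finite index type `β` and all monotone families
`F, G` of up-sets, `0 ≤ triW P F G`.  Proof: the sandwich principle (`…TriWSandwich`) with the certificates of `…TriWFibreFourCert`. [this work] -/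
theorem triW_nonneg_fin_four (P : Finset (Finset (Fin 4))) (hP : IsUpperSet (P : Set (Finset (Fin 4))))
    (F G : Finset β → Finset (Finset (Fin 4)))
    (hF : ∀ x, IsUpperSet (F x : Set (Finset (Fin 4)))) (hG : ∀ x, IsUpperSet (G x : Set (Finset (Fin 4))))
    (hFm : Monotone F) (hGm : Monotone G) :
    0 ≤ triW P F G :=
  triW_nonneg_of_sandwichCert (row_of_mem P P P hP hP hP).1 (fun _ => monoLit_litF _) (fun _ => monoLit_litF _)
    (sandwichCert_fin_four P hP) F G hF hG hFm hGm

end FiveUpSet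

end Summit.CriticalPhenomena.PercolationContinuityZ3.Theorems
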